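import Summits.QuantumFields.BalabanUV.T4Continuum.Support.AveragingDeficitFluxExpansion
import Summits.QuantumFields.BalabanUV.T4Continuum.Support.AveragingDeficitLatticeH2
import HarnessLib

/-!
# AveragingDeficitKDatum (T⁴ programme, node NE3, row NE3-R2, gen 4) — THE K-DATUM FROM PRINTED-TYPE SUP REGULARITY,
# ONE CUBE: for `U(N)`-valued `V` admitting on the fat cube `box (R+M+2) y` a local exponential gauge `V^u = exp a` with
# `‖a‖ ≤ α₀`, `‖∇a‖ ≤ α₁` (`≤ 1/8`), `‖Δa‖ ≤ α₂` (the SHAPE `ExpGauge` = B11 Thm 1 (8)+(10) TYPE read on one cube),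
# `gradFluxSq V (box R y) ≤ #box (R+M+2) y · d·#Plane·[16 d N ((d+1)α₂² + d(6d+1)α₁²/M²) + 2 kRem(α₀,α₁)²]`

HONEST FRAMING (cell `pub-balaban`, T4-DAG PAGE 1; unit `b2b-balaban-t4-ne3r2-p1` = owner of BINDER-OWNERS row NE3-R2,
gen 4).  The cell's T4 target is the finite-torus continuum limit of the unit-scale averaged loop expectations — NOT
infinite volume, NO mass gap, NOT Clay, NOT summit progress.  This is a DICTIONARY theorem: it converts the printed TYPE of
B11 Theorem 1's regularity ((8): sup bounds on the potential and its first differences in a local gauge per cube; (10):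
sup bound on the flat Laplacian) into the `ℓ²` datum `‖∇_U F‖_{ℓ²(cube)}` (`T4AveragingDeficitWall.gradFluxSq`) that the
NE3 energy route (this row's `dualResidual_torus`) and row NE3's action sandwich (`MinimalActionRate.Regular.grad`) consume
— the step recorded as «(9)ˢᵘᵖ + (10) via interior H², folklore» in `t4/T4-EST-NE3-P2.md` §3.8 and in the docstring of
`MinimalActionRate.Regular`.  It does NOT assert that Bałaban's minimisers admit such gauges (that is B11 Theorem 1
itself, asserted by nobody in the tree); NE3 is NOT proved by anything here.

CONTENT (all [folklore], 0 sorry): §1 GAUGE COVARIANCE — `fhol_gaugeAct`, `flux_gaugeAct` (via `mlog_units_conj`),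
`covGrad_flux_gaugeAct`, `gaugeAct_inv_gaugeAct`, `isUnitaryCfg_gaugeAct`, **`norm_covGrad_flux_eq_of_gaugeAct`** (the
summand of `gradFluxSq` is gauge invariant); §2 the SHAPE **`ExpGauge d V y K α₀ α₁ α₂`** (`∃` unitary `u`, potential `a`:
`V^u = exp a`, `‖a‖ ≤ α₀`, `‖∇_i a‖ ≤ α₁`, `‖Δa‖ ≤ α₂` on `box K y`), `ExpGauge.mono`, `expGauge_flat`, `mem_box_add_of_l1`;
§3 `eSq`, `opNorm_sq_le_eSq`, `eSq_le` (`‖X‖² ≤ Σ|X_{kl}|² ≤ N‖X‖²`, `MatrixNorms`), `fd_eq_fwdDiff` (library fit),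
**`latticeH2_matrix`** (discrete Caccioppoli for matrix fields in the operator norm: entrywise `latticeH2` with `E = ℂ`);
§4 the names `wRad`, `kRem` (+ `kRem_nonneg'`, `kRem_le'`) for the radius and remainder written out in
`AveragingDeficitFluxExpansion`, `kBox`, `hess`, `sq_covGrad_le` (`‖∇_V F(x,κ;π)‖² ≤ 8H(x) + 2kRem²` on the inner cube),
**`gradFluxSq_box_le`** (the displayed cube theorem), `kReg` (the constant of the sequel `AveragingDeficitKDatumTorus`:
covering of the period by block cubes, scaling `α_i = c_i/L^{(i+1)j}`, `M = L^j`, the `Regular.grad` corollary).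
Context: T. Bałaban, Commun. Math. Phys. **102** (1985) 277–309 [Balaban1985Variational], Thm 1 (8)–(10) p. 279;
**98** (1985) 17–51 [Balaban1985Averaging] (8) p. 18 (gauge transformations), (21) p. 21.  No printed sentence is a
hypothesis.  PLACEMENT: `Summits/QuantumFields/BalabanUV/` (human rule 2026-08-19).  Record: HOME `t4/T4-EST-NE3-R2.md` v0.5.
-/

set_option autoImplicit false

open scoped BigOperators Matrix.Norms.L2Operator
open NormedSpace

namespace Summit.QuantumFields.BalabanUV.T4Continuum.AveragingDeficitKDatum

open Literature.MathematicalPhysics.QuantumFieldTheory.Balaban1983to89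
open B7Prop1Explicit B7Prop2Explicit MatrixLog UnitaryModel
open T4AveragingDeficitWall hiding Site Plane Plaq Bond
open T4AveragingDeficitWallBoundary (IsPeriodicCfg periodBox blockSites_periodBox sum_blocks_eq card_periodBox)
open T4AveragingDeficitNonAbelian (Ad_mul Ad_sub)
open Beta.TransportVertices (holonomy expTail)
open AveragingDeficitTransport (norm_Ad_of_unitary mem_U1_of_unitary)
open AveragingDeficitCounting (box_mono self_mem_box mem_box_iff box_subset_box_of_mem card_box_eq
  smul_add_boxVec_mem_box)
open AveragingDeficitLatticeH2Prep (fd sd lap)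
open AveragingDeficitLatticeH2 (latticeH2)
open AveragingDeficitFluxExpansion (wRad_le_half norm_covGrad_flux_le norm_fhol_sub_one_le kRem_nonneg kRem_le)

noncomputable section

variable {d : ℕ} {n : Type*} [Fintype n] [DecidableEq n]


/-! ## §1 Gauge covariance of the flux and of its covariant gradient -/

/-- The plaquette variable of a gauge-transformed configuration: `V^u(∂p) = u(z) V(∂p) u(z)⁻¹`. [folklore] -/
theorem fhol_gaugeAct (u : Site d → (Matrix n n ℂ)ˣ) (V : Site d → Fin d → (Matrix n n ℂ)ˣ) (p : T4AveragingDeficitWall.Plaq d) :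
    fhol (gaugeAct u V) p = u p.1 * fhol V p * (u p.1)⁻¹ :=
  hol_gaugeAct_closed u V p.1 _ (disp_plaqWord _ _)

/-- The flux transforms covariantly: `F^u(p) = Ad_{u(z)} F(p)` (for `|V(∂p) − 1| < 1`, unitary `u`). [folklore] -/
theorem flux_gaugeAct [Nonempty n] {u : Site d → (Matrix n n ℂ)ˣ} (hu : ∀ z, u z ∈ unitaryUnits (Matrix n n ℂ)) (V : Site d → Fin d → (Matrix n n ℂ)ˣ)
    (p : T4AveragingDeficitWall.Plaq d) (hp : ‖((fhol V p : (Matrix n n ℂ)ˣ) : (Matrix n n ℂ)) - 1‖ < 1) :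
    flux (gaugeAct u V) p = Ad (u p.1) (flux V p) := by
  unfold flux Ad
  rw [fhol_gaugeAct, Units.val_mul, Units.val_mul]
  exact mlog_units_conj (mem_U1_of_unitary (hu _)) hp

/-- The covariant flux gradient transforms covariantly: `(∇_{V^u} F^u)(x,κ;π) = Ad_{u(x)} (∇_V F)(x,κ;π)`. [folklore] -/
theorem covGrad_flux_gaugeAct [Nonempty n] {u : Site d → (Matrix n n ℂ)ˣ} (hu : ∀ z, u z ∈ unitaryUnits (Matrix n n ℂ))
    (V : Site d → Fin d → (Matrix n n ℂ)ˣ) (x : Site d) (κ : Fin d) (π : T4AveragingDeficitWall.Plane d)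
    (hp : ‖((fhol V (x, π) : (Matrix n n ℂ)ˣ) : (Matrix n n ℂ)) - 1‖ < 1) (hp' : ‖((fhol V (x + e κ, π) : (Matrix n n ℂ)ˣ) : (Matrix n n ℂ)) - 1‖ < 1) :
    covGrad (gaugeAct u V) (flux (gaugeAct u V)) x κ π = Ad (u x) (covGrad V (flux V) x κ π) := by
  unfold covGrad
  rw [flux_gaugeAct hu V _ hp', flux_gaugeAct hu V _ hp, Ad_sub]
  change Ad (u x * V x κ * (u (x + e κ))⁻¹) (Ad (u (x + e κ)) (flux V (x + e κ, π))) - Ad (u x) (flux V (x, π)) = _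
  rw [← Ad_mul, inv_mul_cancel_right, Ad_mul]

/-- Undoing a gauge transformation. [folklore] -/
theorem gaugeAct_inv_gaugeAct (u : Site d → (Matrix n n ℂ)ˣ) (V : Site d → Fin d → (Matrix n n ℂ)ˣ) :
    gaugeAct (fun z => (u z)⁻¹) (gaugeAct u V) = V := by
  funext z μ
  simp only [gaugeAct, inv_inv]
  group

/-- A gauge transform of a `U(N)` configuration by unitaries is `U(N)`-valued. [folklore] -/
theorem isUnitaryCfg_gaugeAct {u : Site d → (Matrix n n ℂ)ˣ} (hu : ∀ z, u z ∈ unitaryUnits (Matrix n n ℂ)) {V : Site d → Fin d → (Matrix n n ℂ)ˣ}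
    (hV : IsUnitaryCfg V) : IsUnitaryCfg (gaugeAct u V) := fun z μ =>
  (unitaryUnits (Matrix n n ℂ)).mul_mem ((unitaryUnits (Matrix n n ℂ)).mul_mem (hu z) (hV z μ)) ((unitaryUnits (Matrix n n ℂ)).inv_mem (hu _))

/-- **GAUGE INVARIANCE OF THE K-DATUM SUMMAND**: if `V′ = V^u` with unitary `u` and the plaquettes of `V′` at `x` and
`x + e_κ` are within `1` of the identity, then `‖(∇_V F)(x,κ;π)‖ = ‖(∇_{V′} F′)(x,κ;π)‖`. [folklore] -/
theorem norm_covGrad_flux_eq_of_gaugeAct [Nonempty n] {u : Site d → (Matrix n n ℂ)ˣ} (hu : ∀ z, u z ∈ unitaryUnits (Matrix n n ℂ))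
    (V : Site d → Fin d → (Matrix n n ℂ)ˣ) (x : Site d) (κ : Fin d) (π : T4AveragingDeficitWall.Plane d)
    (hp : ‖((fhol (gaugeAct u V) (x, π) : (Matrix n n ℂ)ˣ) : (Matrix n n ℂ)) - 1‖ < 1)
    (hp' : ‖((fhol (gaugeAct u V) (x + e κ, π) : (Matrix n n ℂ)ˣ) : (Matrix n n ℂ)) - 1‖ < 1) :
    ‖covGrad V (flux V) x κ π‖ = ‖covGrad (gaugeAct u V) (flux (gaugeAct u V)) x κ π‖ := by
  have hu' : ∀ z, (u z)⁻¹ ∈ unitaryUnits (Matrix n n ℂ) := fun z => (unitaryUnits (Matrix n n ℂ)).inv_mem (hu z)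
  have h := covGrad_flux_gaugeAct hu' (gaugeAct u V) x κ π hp hp'
  rw [gaugeAct_inv_gaugeAct] at h
  rw [h, norm_Ad_of_unitary (hu' x)]

/-! ## §2 The local exponential gauge (B11 Thm 1 (8)+(10) TYPE, per cube) -/

variable (d) in
/-- **LOCAL EXPONENTIAL GAUGE WITH SUP REGULARITY** (a SHAPE — the TYPE of B11 Theorem 1 (8) + (10) read on one cube,
asserted for no configuration here): on the cube `box K y` the configuration `V` is, after a unitary gauge
transformation `u`, of the form `V^u(b) = exp a(b)` with `‖a‖ ≤ α₀`, all first differences `‖∇_i a‖ ≤ α₁` ((8):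
`|A| < B₃Mε₁(L^jη)⁻¹`, `|∇^ηA| < B₃Mε₁(L^jη)⁻²`, in lattice units) and flat componentwise Laplacian `‖Δa‖ ≤ α₂` ((10):
`|Δ^ηA| < B₃Mε₁(L^jη)⁻³`).  Context: [Balaban1985Variational] Thm 1 (8)–(10) p. 279. [folklore] -/
@[folklore]
def ExpGauge (V : Site d → Fin d → (Matrix n n ℂ)ˣ) (y : Site d) (K : ℕ) (α₀ α₁ α₂ : ℝ) : Prop :=
  ∃ (u : Site d → (Matrix n n ℂ)ˣ) (a : Site d → Fin d → (Matrix n n ℂ)), (∀ z, u z ∈ unitaryUnits (Matrix n n ℂ)) ∧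
    (∀ z τ, z ∈ box K y → ((gaugeAct u V z τ : (Matrix n n ℂ)ˣ) : (Matrix n n ℂ)) = exp (a z τ)) ∧
    (∀ z τ, z ∈ box K y → ‖a z τ‖ ≤ α₀) ∧
    (∀ (z : Site d) (τ i : Fin d), z ∈ box K y → ‖fd i (fun w => a w τ) z‖ ≤ α₁) ∧
    (∀ z τ, z ∈ box K y → ‖lap (fun w => a w τ) z‖ ≤ α₂)

/-- `ExpGauge` is monotone in the cube. [folklore] -/
theorem ExpGauge.mono {V : Site d → Fin d → (Matrix n n ℂ)ˣ} {y : Site d} {K K' : ℕ} {α₀ α₁ α₂ : ℝ} (h : ExpGauge d V y K α₀ α₁ α₂)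
    (hK : K' ≤ K) : ExpGauge d V y K' α₀ α₁ α₂ := by
  obtain ⟨u, a, hu, he, h0, h1, h2⟩ := h
  have hs := box_mono hK y
  exact ⟨u, a, hu, fun z τ hz => he z τ (hs hz), fun z τ hz => h0 z τ (hs hz), fun z τ i hz => h1 z τ i (hs hz),
    fun z τ hz => h2 z τ (hs hz)⟩

/-- NON-VACUITY: the flat configuration is in the exponential gauge `u = 1`, `a = 0` with all radii `0`. [folklore] -/
theorem expGauge_flat (y : Site d) (K : ℕ) : ExpGauge d (fun (_ : Site d) (_ : Fin d) => (1 : (Matrix n n ℂ)ˣ)) y K 0 0 0 := by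
  refine ⟨fun _ => 1, fun _ _ => 0, fun _ => (unitaryUnits (Matrix n n ℂ)).one_mem, fun z τ _ => ?_, fun _ _ _ => by simp,
    fun _ _ _ _ => by simp [fd], fun _ _ _ => by simp [lap, sd]⟩
  simp [gaugeAct]

/-- `ℓ¹`-closeness to a point of a cube gives membership in the enlarged cube. [folklore] -/
theorem mem_box_add_of_l1 {R m : ℕ} {y x z : Site d} (hx : x ∈ box R y) (hz : l1 (z - x) ≤ m) :
    z ∈ box (R + m) y := by
  refine box_subset_box_of_mem hx (mem_box_iff.mpr fun κ => ?_)
  have h1 : ((z - x) κ).natAbs ≤ l1 (z - x) :=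
    Finset.single_le_sum (f := fun κ => ((z - x) κ).natAbs) (fun _ _ => Nat.zero_le _) (Finset.mem_univ κ)
  rw [show z κ - x κ = (z - x) κ from rfl, ← Int.natCast_natAbs]
  exact_mod_cast h1.trans hz


/-! ## §3 From operator norms to entries and back: the discrete Caccioppoli inequality for matrix fields -/

/-- The entrywise square norm `Σ_{k,l} |X_{kl}|²`. [folklore] -/
def eSq (X : (Matrix n n ℂ)) : ℝ := ∑ p : n × n, ‖X p.1 p.2‖ ^ 2

/-- `‖X‖² ≤ Σ_{k,l}|X_{kl}|²` (operator norm (19) against the entrywise norm). [folklore] -/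
theorem opNorm_sq_le_eSq (X : (Matrix n n ℂ)) : ‖X‖ ^ 2 ≤ eSq X := by
  rw [eSq, Fintype.sum_prod_type]; exact MatrixNorms.opNorm_sq_le_sum_norm_sq X

/-- `Σ_{k,l}|X_{kl}|² ≤ N·‖X‖²`. [folklore] -/
theorem eSq_le [Nonempty n] (X : (Matrix n n ℂ)) : eSq X ≤ Fintype.card n * ‖X‖ ^ 2 := by
  rw [eSq, Fintype.sum_prod_type, ← MatrixNorms.card_mul_nhsNormSq]
  exact mul_le_mul_of_nonneg_left (MatrixNorms.nhsNormSq_le_opNorm_sq X) (Nat.cast_nonneg _)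

/-- Library fit (review of p206058): the support alias `fd i` IS Mathlib's forward difference `fwdDiff (e i)`.
[folklore] -/
theorem fd_eq_fwdDiff {E : Type*} [NormedAddCommGroup E] (i : Fin d) (f : Site d → E) : fd i f = fwdDiff (e i) f := rfl

/-- Entries commute with differences. [folklore] -/
theorem fd_apply (i : Fin d) (G : Site d → (Matrix n n ℂ)) (x : Site d) (k l : n) : fd i G x k l = fd i (fun w => G w k l) x := by
  simp only [fd, Matrix.sub_apply]

/-- Entries commute with second differences. [folklore] -/
theorem fd_fd_apply (i j : Fin d) (G : Site d → (Matrix n n ℂ)) (x : Site d) (k l : n) :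
    fd i (fd j G) x k l = fd i (fd j (fun w => G w k l)) x := by simp only [fd, Matrix.sub_apply]

/-- Entries commute with the Laplacian. [folklore] -/
theorem lap_apply (G : Site d → (Matrix n n ℂ)) (x : Site d) (k l : n) : lap G x k l = lap (fun w => G w k l) x := by
  simp only [lap, sd, Matrix.sum_apply, Matrix.sub_apply]

/-- **DISCRETE CACCIOPPOLI FOR MATRIX FIELDS IN THE OPERATOR NORM** (entrywise `latticeH2` with `E = ℂ`, then
`‖X‖² ≤ Σ|X_{kl}|² ≤ N‖X‖²`):
`Σ_{box R}Σ_{ij}‖D_iD_jG‖² ≤ N·[2(d+1)Σ_{box R+M+2}‖ΔG‖² + 2(6d+1)/M²·Σ_{box R+M+2}Σ_i‖D_iG‖²]`. [folklore] -/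
theorem latticeH2_matrix [Nonempty n] (G : Site d → (Matrix n n ℂ)) (y : Site d) (R M : ℕ) (hM : 1 ≤ M) :
    ∑ x ∈ box R y, ∑ i, ∑ j, ‖fd i (fd j G) x‖ ^ 2
      ≤ Fintype.card n * (2 * (d + 1) * ∑ x ∈ box (R + M + 2) y, ‖lap G x‖ ^ 2
        + 2 * (6 * d + 1) / (M : ℝ) ^ 2 * ∑ x ∈ box (R + M + 2) y, ∑ i, ‖fd i G x‖ ^ 2) := by
  set Ω := box (R + M + 2) y
  -- entrywise Caccioppoli, summed over the entries
  have hkl : ∀ p : n × n, ∑ x ∈ box R y, ∑ i, ∑ j, ‖fd i (fd j (fun w => G w p.1 p.2)) x‖ ^ 2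
      ≤ 2 * (d + 1) * ∑ x ∈ Ω, ‖lap (fun w => G w p.1 p.2) x‖ ^ 2
        + 2 * (6 * d + 1) / (M : ℝ) ^ 2 * ∑ x ∈ Ω, ∑ i, ‖fd i (fun w => G w p.1 p.2) x‖ ^ 2 :=
    fun p => latticeH2 (E := ℂ) _ y R M hM
  have hsum := Finset.sum_le_sum fun p (_ : p ∈ (Finset.univ : Finset (n × n))) => hkl p
  rw [Finset.sum_add_distrib, ← Finset.mul_sum, ← Finset.mul_sum] at hsum
  -- left side: operator norm ≤ entrywise
  have hL : ∑ x ∈ box R y, ∑ i, ∑ j, ‖fd i (fd j G) x‖ ^ 2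
      ≤ ∑ p : n × n, ∑ x ∈ box R y, ∑ i, ∑ j, ‖fd i (fd j (fun w => G w p.1 p.2)) x‖ ^ 2 := by
    calc ∑ x ∈ box R y, ∑ i, ∑ j, ‖fd i (fd j G) x‖ ^ 2
        ≤ ∑ x ∈ box R y, ∑ i, ∑ j, ∑ p : n × n, ‖fd i (fd j (fun w => G w p.1 p.2)) x‖ ^ 2 := by
          gcongr with x _ i _ j _
          refine (opNorm_sq_le_eSq _).trans (le_of_eq (Finset.sum_congr rfl fun p _ => ?_))
          rw [fd_fd_apply]
      _ = ∑ x ∈ box R y, ∑ i, ∑ p : n × n, ∑ j, ‖fd i (fd j (fun w => G w p.1 p.2)) x‖ ^ 2 :=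
          Finset.sum_congr rfl fun x _ => Finset.sum_congr rfl fun i _ => Finset.sum_comm
      _ = ∑ x ∈ box R y, ∑ p : n × n, ∑ i, ∑ j, ‖fd i (fd j (fun w => G w p.1 p.2)) x‖ ^ 2 :=
          Finset.sum_congr rfl fun x _ => Finset.sum_comm
      _ = ∑ p : n × n, ∑ x ∈ box R y, ∑ i, ∑ j, ‖fd i (fd j (fun w => G w p.1 p.2)) x‖ ^ 2 := Finset.sum_comm
  -- right side: entrywise ≤ N · operator norm
  have hA : ∑ p : n × n, ∑ x ∈ Ω, ‖lap (fun w => G w p.1 p.2) x‖ ^ 2 ≤ ∑ x ∈ Ω, Fintype.card n * ‖lap G x‖ ^ 2 := by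
    rw [Finset.sum_comm]
    refine Finset.sum_le_sum fun x _ => ?_
    refine (le_of_eq (Finset.sum_congr rfl fun p _ => ?_)).trans (eSq_le (lap G x))
    rw [lap_apply]
  have hB : ∑ p : n × n, ∑ x ∈ Ω, ∑ i, ‖fd i (fun w => G w p.1 p.2) x‖ ^ 2
      ≤ ∑ x ∈ Ω, ∑ i, Fintype.card n * ‖fd i G x‖ ^ 2 := by
    rw [Finset.sum_comm]
    refine Finset.sum_le_sum fun x _ => ?_
    rw [Finset.sum_comm]
    refine Finset.sum_le_sum fun i _ => ?_
    refine (le_of_eq (Finset.sum_congr rfl fun p _ => ?_)).trans (eSq_le (fd i G x))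
    rw [fd_apply]
  rw [← Finset.mul_sum] at hA
  simp only [← Finset.mul_sum] at hB
  have hM2 : (0 : ℝ) ≤ 2 * (6 * d + 1) / (M : ℝ) ^ 2 := by positivity
  have hd1 : (0 : ℝ) ≤ 2 * (d + 1) := by positivity
  calc _ ≤ _ := hL
    _ ≤ _ := hsum
    _ ≤ 2 * (d + 1) * (Fintype.card n * ∑ x ∈ Ω, ‖lap G x‖ ^ 2)
        + 2 * (6 * d + 1) / (M : ℝ) ^ 2 * (Fintype.card n * ∑ x ∈ Ω, ∑ i, ‖fd i G x‖ ^ 2) :=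
          add_le_add (mul_le_mul_of_nonneg_left hA hd1) (mul_le_mul_of_nonneg_left hB hM2)
    _ = _ := by ring

/-! ## §4 THE CUBE THEOREM -/

/-- The radius `w(α₀, α₁) = 2α₁ + ρ(4α₀)`, `ρ(t) = e^t − 1 − t`: the size of `V(∂p) − 1` in a local exponential gauge
(`AveragingDeficitFluxExpansion.norm_fhol_sub_one_le`; `≤ 1/2` for `α₀, α₁ ≤ 1/8`, `wRad_le_half`). [folklore] -/
def wRad (α₀ α₁ : ℝ) : ℝ := 2 * α₁ + expRem (4 * α₀)

/-- THE REMAINDER of the pointwise expansion `AveragingDeficitFluxExpansion.norm_covGrad_flux_le` (every term a product of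
sup quantities, third order in the scaling `α₀ ~ L^{−j}`, `α₁ ~ L^{−2j}`):
`kRem = 16α₀α₁ + 2T₃(4α₀) + 2ρ(2w) + 4(e^{α₀} − 1)w`, `w = wRad α₀ α₁`, `T₃(t) = e^t − 1 − t − t²/2`. [folklore] -/
def kRem (α₀ α₁ : ℝ) : ℝ :=
  16 * α₀ * α₁ + 2 * expTail 3 (4 * α₀) + 2 * expRem (2 * (2 * α₁ + expRem (4 * α₀)))
    + 4 * (Real.exp α₀ - 1) * (2 * α₁ + expRem (4 * α₀))

/-- `0 ≤ kRem`. [folklore] -/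
theorem kRem_nonneg' {α₀ α₁ : ℝ} (hα₀ : 0 ≤ α₀) (hα₁ : 0 ≤ α₁) : 0 ≤ kRem α₀ α₁ := kRem_nonneg hα₀ hα₁

/-- `kRem ≤ 90α₀α₁ + 32α₁² + 360α₀³` in the regime `α₀, α₁ ≤ 1/8`. [folklore] -/
theorem kRem_le' {α₀ α₁ : ℝ} (hα₀ : 0 ≤ α₀) (hα₁ : 0 ≤ α₁) (hα₀' : α₀ ≤ 1 / 8) (hα₁' : α₁ ≤ 1 / 8) :
    kRem α₀ α₁ ≤ 90 * α₀ * α₁ + 32 * α₁ ^ 2 + 360 * α₀ ^ 3 := kRem_le hα₀ hα₁ hα₀' hα₁'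

/-- The cube constant: `d·#Plane·[16 d N ((d+1)α₂² + d(6d+1)α₁²/M²) + 2·kRem(α₀,α₁)²]`. [folklore] -/
def kBox (d N M : ℕ) (α₀ α₁ α₂ : ℝ) : ℝ :=
  d * Fintype.card (T4AveragingDeficitWall.Plane d) *
    (16 * d * N * ((d + 1) * α₂ ^ 2 + d * (6 * d + 1) * α₁ ^ 2 / (M : ℝ) ^ 2) + 2 * kRem α₀ α₁ ^ 2)

/-- `0 ≤ kBox`. [folklore] -/
theorem kBox_nonneg (d N M : ℕ) (α₀ α₁ α₂ : ℝ) : 0 ≤ kBox d N M α₀ α₁ α₂ := by unfold kBox; positivity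

/-- The mixed-second-difference energy of the potential at a site: `H(x) = Σ_τ Σ_i Σ_j ‖D_iD_j a_τ(x)‖²`. [folklore] -/
def hess (a : Site d → Fin d → (Matrix n n ℂ)) (x : Site d) : ℝ :=
  ∑ τ : Fin d, ∑ i, ∑ j, ‖fd i (fd j (fun w => a w τ)) x‖ ^ 2

/-- One mixed second difference is at most `H(x)`. [folklore] -/
theorem sq_fd_fd_le_hess (a : Site d → Fin d → (Matrix n n ℂ)) (x : Site d) (i j τ : Fin d) :
    ‖fd i (fd j (fun w => a w τ)) x‖ ^ 2 ≤ hess a x := by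
  unfold hess
  refine le_trans ?_ (Finset.single_le_sum (f := fun τ' => ∑ i', ∑ j', ‖fd i' (fd j' (fun w => a w τ')) x‖ ^ 2)
    (fun _ _ => by positivity) (Finset.mem_univ τ))
  refine le_trans ?_ (Finset.single_le_sum (f := fun i' => ∑ j', ‖fd i' (fd j' (fun w => a w τ)) x‖ ^ 2)
    (fun _ _ => by positivity) (Finset.mem_univ i))
  exact Finset.single_le_sum (f := fun j' => ‖fd i (fd j' (fun w => a w τ)) x‖ ^ 2)
    (fun _ _ => by positivity) (Finset.mem_univ j)

/-- THE POINTWISE SQUARED BOUND at a site of the inner cube: `‖(∇_V F)(x,κ;π)‖² ≤ 8 H(x) + 2 kRem²`. [folklore] -/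
theorem sq_covGrad_le [Nonempty n] {V : Site d → Fin d → (Matrix n n ℂ)ˣ} (hV : IsUnitaryCfg V) {y : Site d} {R K : ℕ}
    (hK : R + 2 ≤ K) {α₀ α₁ : ℝ} (hα₀ : 0 ≤ α₀) (hα₁ : 0 ≤ α₁) (hα₀' : α₀ ≤ 1 / 8) (hα₁' : α₁ ≤ 1 / 8)
    {u : Site d → (Matrix n n ℂ)ˣ} {a : Site d → Fin d → (Matrix n n ℂ)} (hu : ∀ z, u z ∈ unitaryUnits (Matrix n n ℂ))
    (he : ∀ z τ, z ∈ box K y → ((gaugeAct u V z τ : (Matrix n n ℂ)ˣ) : (Matrix n n ℂ)) = exp (a z τ))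
    (h0 : ∀ z τ, z ∈ box K y → ‖a z τ‖ ≤ α₀)
    (h1 : ∀ (z : Site d) (τ i : Fin d), z ∈ box K y → ‖fd i (fun w => a w τ) z‖ ≤ α₁)
    {x : Site d} (hx : x ∈ box R y) (κ : Fin d) (π : T4AveragingDeficitWall.Plane d) :
    ‖covGrad V (flux V) x κ π‖ ^ 2 ≤ 8 * hess a x + 2 * kRem α₀ α₁ ^ 2 := by
  obtain ⟨⟨μ, ν⟩, hlt⟩ := π
  -- the hypotheses of the pointwise expansion, for `V′ = V^u` around `x`
  have hexp : ∀ z τ, l1 (z - x) ≤ 2 → ((gaugeAct u V z τ : (Matrix n n ℂ)ˣ) : (Matrix n n ℂ)) = exp (a z τ) :=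
    fun z τ hz => he z τ (box_mono hK y (mem_box_add_of_l1 hx hz))
  have h0' : ∀ z τ, l1 (z - x) ≤ 2 → ‖a z τ‖ ≤ α₀ :=
    fun z τ hz => h0 z τ (box_mono hK y (mem_box_add_of_l1 hx hz))
  have h1' : ∀ z τ i, l1 (z - x) ≤ 1 → ‖fd i (fun w => a w τ) z‖ ≤ α₁ :=
    fun z τ i hz => h1 z τ i (box_mono (by omega) y (mem_box_add_of_l1 (m := 1) hx hz))
  have hV' : IsUnitaryCfg (gaugeAct u V) := isUnitaryCfg_gaugeAct hu hV
  -- gauge invariance, then the expansion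
  have hw := wRad_le_half hα₀ hα₀' hα₁'
  obtain ⟨hp, hp'⟩ := norm_fhol_sub_one_le hexp h0' h1' κ μ ν hlt
  have hmain : ‖covGrad (gaugeAct u V) (flux (gaugeAct u V)) x κ ⟨(μ, ν), hlt⟩‖
      ≤ ‖fd μ (fd κ (fun w => a w ν)) x - fd ν (fd κ (fun w => a w μ)) x‖ + kRem α₀ α₁ :=
    norm_covGrad_flux_le hV' hα₀ hα₁ hα₀' hα₁' hexp h0' h1' κ μ ν hlt
  rw [norm_covGrad_flux_eq_of_gaugeAct hu V x κ ⟨(μ, ν), hlt⟩ (by linarith) (by linarith)]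
  set A := fd μ (fd κ (fun w => a w ν)) x
  set B := fd ν (fd κ (fun w => a w μ)) x
  have hAB : ‖A - B‖ ≤ ‖A‖ + ‖B‖ := norm_sub_le _ _
  have hA2 : ‖A‖ ^ 2 ≤ hess a x := sq_fd_fd_le_hess a x μ κ ν
  have hB2 : ‖B‖ ^ 2 ≤ hess a x := sq_fd_fd_le_hess a x ν κ μ
  have hk0 := kRem_nonneg' hα₀ hα₁
  have h3 : ‖covGrad (gaugeAct u V) (flux (gaugeAct u V)) x κ ⟨(μ, ν), hlt⟩‖ ≤ ‖A‖ + ‖B‖ + kRem α₀ α₁ := by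
    linarith
  calc ‖covGrad (gaugeAct u V) (flux (gaugeAct u V)) x κ ⟨(μ, ν), hlt⟩‖ ^ 2
      ≤ (‖A‖ + ‖B‖ + kRem α₀ α₁) ^ 2 := pow_le_pow_left₀ (norm_nonneg _) h3 2
    _ ≤ 4 * ‖A‖ ^ 2 + 4 * ‖B‖ ^ 2 + 2 * kRem α₀ α₁ ^ 2 := by
        nlinarith [sq_nonneg (‖A‖ - ‖B‖), sq_nonneg (‖A‖ + ‖B‖ - kRem α₀ α₁), norm_nonneg A, norm_nonneg B]
    _ ≤ _ := by linarith

/-- **THE CUBE THEOREM (K-datum from printed-type sup regularity, one cube).**  If `V` is `U(N)`-valued and admits on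
the fat cube `box (R+M+2) y` a local exponential gauge with sup radii `α₀, α₁ ≤ 1/8` and `α₂` (`ExpGauge`), then
`gradFluxSq V (box R y) ≤ #box (R+M+2) y · kBox d N M α₀ α₁ α₂`, i.e.
`‖∇_V F‖²_{ℓ²(box R y)} ≤ #(fat cube)·d·#Plane·[16dN((d+1)α₂² + d(6d+1)α₁²/M²) + 2kRem(α₀,α₁)²]` —
the mixed second differences through the discrete Caccioppoli inequality (`latticeH2_matrix`), everything else
through the pointwise expansion; no constant depends on `R`, `y` or `V`. [folklore] -/
theorem gradFluxSq_box_le [Nonempty n] {V : Site d → Fin d → (Matrix n n ℂ)ˣ} (hV : IsUnitaryCfg V) {y : Site d} {R M : ℕ}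
    (hM : 1 ≤ M) {α₀ α₁ α₂ : ℝ} (hα₀ : 0 ≤ α₀) (hα₁ : 0 ≤ α₁) (hα₀' : α₀ ≤ 1 / 8) (hα₁' : α₁ ≤ 1 / 8)
    (hG : ExpGauge d V y (R + M + 2) α₀ α₁ α₂) :
    gradFluxSq V (box R y) ≤ ((box (R + M + 2) y).card : ℝ) * kBox d (Fintype.card n) M α₀ α₁ α₂ := by
  obtain ⟨u, a, hu, he, h0, h1, h2⟩ := hG
  set Ω := box (R + M + 2) y with hΩ
  set P : ℝ := ((Fintype.card (T4AveragingDeficitWall.Plane d) : ℕ) : ℝ) with hP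
  have hk0 := kRem_nonneg' hα₀ hα₁
  have hcard : ((box R y).card : ℝ) ≤ Ω.card := by
    exact_mod_cast Finset.card_le_card (box_mono (by omega) y)
  -- pointwise, summed over directions and planes
  have hpt : ∀ x ∈ box R y, ∑ κ : Fin d, ∑ π : T4AveragingDeficitWall.Plane d, ‖covGrad V (flux V) x κ π‖ ^ 2
      ≤ d * P * (8 * hess a x + 2 * kRem α₀ α₁ ^ 2) := by
    intro x hx
    calc ∑ κ : Fin d, ∑ π : T4AveragingDeficitWall.Plane d, ‖covGrad V (flux V) x κ π‖ ^ 2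
        ≤ ∑ _κ : Fin d, ∑ _π : T4AveragingDeficitWall.Plane d, (8 * hess a x + 2 * kRem α₀ α₁ ^ 2) :=
          Finset.sum_le_sum fun κ _ => Finset.sum_le_sum fun π _ =>
            sq_covGrad_le hV (K := R + M + 2) (by omega) hα₀ hα₁ hα₀' hα₁' hu he h0 h1 hx κ π
      _ = d * P * (8 * hess a x + 2 * kRem α₀ α₁ ^ 2) := by
          rw [Finset.sum_const, Finset.sum_const, Finset.card_univ, Finset.card_univ, Fintype.card_fin, hP]
          simp only [nsmul_eq_mul]
          ring
  -- the Caccioppoli step for each component of the potential, then the sup bounds on the fat cube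
  have hH : ∑ x ∈ box R y, hess a x
      ≤ d * (Fintype.card n * (2 * (d + 1) * (Ω.card * α₂ ^ 2)
        + 2 * (6 * d + 1) / (M : ℝ) ^ 2 * (Ω.card * (d * α₁ ^ 2)))) := by
    unfold hess
    rw [Finset.sum_comm]
    have per : ∀ τ : Fin d, ∑ x ∈ box R y, ∑ i, ∑ j, ‖fd i (fd j (fun w => a w τ)) x‖ ^ 2
        ≤ Fintype.card n * (2 * (d + 1) * (Ω.card * α₂ ^ 2)
          + 2 * (6 * d + 1) / (M : ℝ) ^ 2 * (Ω.card * (d * α₁ ^ 2))) := by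
      intro τ
      refine (latticeH2_matrix (fun w => a w τ) y R M hM).trans ?_
      have hlap : ∑ x ∈ Ω, ‖lap (fun w => a w τ) x‖ ^ 2 ≤ Ω.card * α₂ ^ 2 := by
        have h := Finset.sum_le_card_nsmul Ω (fun x => ‖lap (fun w => a w τ) x‖ ^ 2) (α₂ ^ 2)
          fun x hx => pow_le_pow_left₀ (norm_nonneg _) (h2 x τ hx) 2
        rwa [nsmul_eq_mul] at h
      have hfd : ∑ x ∈ Ω, ∑ i, ‖fd i (fun w => a w τ) x‖ ^ 2 ≤ Ω.card * (d * α₁ ^ 2) := by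
        have h := Finset.sum_le_card_nsmul Ω (fun x => ∑ i, ‖fd i (fun w => a w τ) x‖ ^ 2) (d * α₁ ^ 2)
          fun x hx => by
            have h' := Finset.sum_le_card_nsmul Finset.univ (fun i => ‖fd i (fun w => a w τ) x‖ ^ 2) (α₁ ^ 2)
              fun i _ => pow_le_pow_left₀ (norm_nonneg _) (h1 x τ i hx) 2
            rwa [Finset.card_univ, Fintype.card_fin, nsmul_eq_mul] at h'
        rwa [nsmul_eq_mul] at h
      have hc1 : (0 : ℝ) ≤ 2 * (d + 1) := by positivity
      have hc2 : (0 : ℝ) ≤ 2 * (6 * d + 1) / (M : ℝ) ^ 2 := by positivity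
      exact mul_le_mul_of_nonneg_left (add_le_add (mul_le_mul_of_nonneg_left hlap hc1)
        (mul_le_mul_of_nonneg_left hfd hc2)) (Nat.cast_nonneg _)
    have h := Finset.sum_le_sum fun τ (_ : τ ∈ (Finset.univ : Finset (Fin d))) => per τ
    rwa [Finset.sum_const, Finset.card_univ, Fintype.card_fin, nsmul_eq_mul] at h
  -- assemble
  unfold gradFluxSq
  have hP0 : 0 ≤ P := by rw [hP]; exact Nat.cast_nonneg _
  have hd0 : (0 : ℝ) ≤ d := Nat.cast_nonneg _
  calc ∑ x ∈ box R y, ∑ κ : Fin d, ∑ π : T4AveragingDeficitWall.Plane d, ‖covGrad V (flux V) x κ π‖ ^ 2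
      ≤ ∑ x ∈ box R y, d * P * (8 * hess a x + 2 * kRem α₀ α₁ ^ 2) := Finset.sum_le_sum hpt
    _ = d * P * (8 * ∑ x ∈ box R y, hess a x + 2 * ((box R y).card * kRem α₀ α₁ ^ 2)) := by
        rw [← Finset.mul_sum, Finset.sum_add_distrib, ← Finset.mul_sum, Finset.sum_const, nsmul_eq_mul]
        ring
    _ ≤ d * P * (8 * (d * (Fintype.card n * (2 * (d + 1) * (Ω.card * α₂ ^ 2)
          + 2 * (6 * d + 1) / (M : ℝ) ^ 2 * (Ω.card * (d * α₁ ^ 2))))) + 2 * (Ω.card * kRem α₀ α₁ ^ 2)) := by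
        gcongr
    _ = (Ω.card : ℝ) * kBox d (Fintype.card n) M α₀ α₁ α₂ := by
        rw [kBox, ← hP]
        ring


/-- The `Regular.grad` constant produced from the printed-type sup constants `c₀, c₁, c₂` (lattice units:
`‖a‖ ≤ c₀/L^j`, `‖∇a‖ ≤ c₁/L^{2j}`, `‖Δa‖ ≤ c₂/L^{3j}`; dictionary `c_i = B₃Mε₁`) by the sequel `AveragingDeficitKDatumTorus`:
`kReg = 7^d · d · #Plane · [16 d N ((d+1)c₂² + d(6d+1)c₁²) + 2(90c₀c₁ + 32c₁² + 360c₀³)²]`. [folklore] -/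
def kReg (d N : ℕ) (c₀ c₁ c₂ : ℝ) : ℝ :=
  7 ^ d * (d * Fintype.card (T4AveragingDeficitWall.Plane d) *
    (16 * d * N * ((d + 1) * c₂ ^ 2 + d * (6 * d + 1) * c₁ ^ 2) + 2 * (90 * c₀ * c₁ + 32 * c₁ ^ 2 + 360 * c₀ ^ 3) ^ 2))

end

end Summit.QuantumFields.BalabanUV.T4Continuum.AveragingDeficitKDatum
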